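import Summits.BirchSwinnertonDyer.BirchSwinnertonDyer.Theorems.AlignedTransportAtTwoMainConjectureOfRankZeroBSDAtTwoFineRoadLimRelUpstairs
import Literature.NumberTheory.EllipticCurves.FineSelmerLimThm35AtTwoUpstairsProofs
import HarnessLib

/-!
# Stub `stub_limUpstairsDoorAtTwo` (LimDoor) of line `birth` (crux C2 `MainConjectureOfRankZeroBSDAtTwo`,
# stmt-BirchSwinnertonDyer-22298) — CLOSED BY NAME: the displayed Lim 2017 door is a kernel theorem

Route `AlignedTransportAtTwo` (ATT), crux C2, line `birth` (skeleton of record 0347ca60038a43ad, LEAD lineage `bsd-line-att-p2`;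
`Cruxes/MainConjectureOfRankZeroBSDAtTwo/Lines/birth.lean` l. 493–496). The registered stub
`stub_limUpstairsDoorAtTwo : LimUpstairsDoorAtTwo`, where `LimUpstairsDoorAtTwo` is BY DEFINITION the tree's named fact
`Literature.NumberTheory.EllipticCurves.Lim2017.thm35_at_two_upstairs_fineSelmer_twoTorsion_finite_of_classicalMuVanishes`
(Lim 2017 Thm. 3.5 «if» at `p = 2`, upstairs, carrier `F = ℚ(E[2], √−1)`), displayed a PRINT hypothesis. That named fact was
DISCHARGED in the kernel by cell bsd-2adic (`Lim2017.…_holds`, `Literature/…/FineSelmerLimThm35AtTwoUpstairsProofs.lean`,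
p716773). This `--supports 22298` helper file (resident INPUTS prover `bsd-inputs-honda-p1` g16, filing service; no mathematics
beyond composition) records the consequences BY NAME:

* `stub_limUpstairsDoorAtTwo` — the registered stub, unconditionally (the LEAD splices
  `exact …Theorems.AlignedTransportAtTwoFineRoad.LimDoor.stub_limUpstairsDoorAtTwo` at `Lines/birth.lean` l. 495–496;
  `LimUpstairsDoorAtTwo` unfolds to the named fact by `rfl`);
* `limRelAtTwo_holds` — stub Limʳ `LimRelAtTwo` of skeletons v6/v7 (text VERBATIM), now UNCONDITIONAL
  (`LimRelUpstairs.limRelAtTwo_of_lim2017` with its door discharged): for `W/ℚ` good ordinary at `2` with no rational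
  `2`-torsion, `i² = −1`, Iwasawa `μ₂ = 0` for the cyclotomic `ℤ₂`-extensions of `ℚ(W[2], i)`, every cyclotomic datum and every
  relaxed-at-`∞` fine dual datum `Yr`: `ℓ₍₂₎(Yr.X) = 0`;
* `exists_fineSelmerDualData_moduleFinite_two` — Coates–Sujatha (A) at `(E, 2)` downstairs in the tree's `∃ γ D` form, from
  the same `μ₂ = 0` hypothesis, unconditionally in the door.

Net effect on the line: the netted road (b″) composition `Birth.MainConjectureOfRankZeroBSDAtTwo_of_roadB2door hP hD hI hμ`
needs only {P = `stub_publishedInputsAtTwo`, MuIneqʳ = `stub_muInequalityRelAtTwo`, PFμ⁺ = `stub_pointFieldMuCycAtTwo`};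
`hD` is this file's first theorem. THEOREMS ONLY — no definition, no named fact, no instance, no `sorry`. The crux C2, its
verdict («blocked-on `Rank1Residual.GreenbergMuConjectureIrreducible`», stub T) and every other stub are untouched; the
Birch–Swinnerton-Dyer conjecture is NOT proved for any curve by any of this.

References: M. F. Lim, *Notes on the fine Selmer groups*, Asian J. Math. 21 (2017) §3 (Lemma 3.2, Thm. 3.5; arXiv:1306.2047
pp. 6–7); J. Coates, R. Sujatha, *Fine Selmer groups of elliptic curves over p-adic Lie extensions*, Math. Ann. 331 (2005) §3
(statement (A), Thm. 3.4); R. Greenberg, LNM 1716 (1999) §4 Lemma 4.6.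
-/

set_option autoImplicit false
-- the Theorems namespace of this sub repeats the summit name by design (D-0017 nested layout)
set_option linter.dupNamespace false

noncomputable section

open scoped Classical

namespace Summit.BirchSwinnertonDyer.BirchSwinnertonDyer.Theorems.AlignedTransportAtTwoFineRoad.LimDoor

open Literature.NumberTheory.EllipticCurves Literature.NumberTheory.GaloisRepresentations
  Literature.NumberTheory.EllipticCurves.Module Literature.NumberTheory.IwasawaTheory
  Literature.NumberTheory.EllipticCurves.Greenberg1999 WeierstrassCurve Field
  Summit.BirchSwinnertonDyer.BirchSwinnertonDyer.Theorems.AlignedTransportAtTwoFineRoad.LimRelUpstairs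

/-- **Registered stub `stub_limUpstairsDoorAtTwo` (LimDoor) of line `birth`, crux C2 stmt-BirchSwinnertonDyer-22298 — CLOSED
BY NAME.** Its type `Birth.LimUpstairsDoorAtTwo` is by definition the named fact
`Lim2017.thm35_at_two_upstairs_fineSelmer_twoTorsion_finite_of_classicalMuVanishes` (Lim 2017 Thm. 3.5 «if» at `p = 2` for the
carrier `F = ℚ(E[2], √−1)`: Iwasawa `μ₂ = 0` in growth form for the cyclotomic `ℤ₂`-extensions of `F` ⟹ the fine Selmer group
of `E[2^∞]` over `ℚ(E[2], μ_{2^∞})` has finite `2`-torsion), which the tree PROVES (`Lim2017.…_holds`, cell bsd-2adic).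
[cite: Lim2017FineSelmer, §3 Thm. 3.5 and Lemma 3.2 (arXiv:1306.2047 pp. 6–7)] [cite: CoatesSujatha2005, §3 statement (A), Thm. 3.4] -/
theorem stub_limUpstairsDoorAtTwo :
    Lim2017.thm35_at_two_upstairs_fineSelmer_twoTorsion_finite_of_classicalMuVanishes :=
  Lim2017.thm35_at_two_upstairs_fineSelmer_twoTorsion_finite_of_classicalMuVanishes_holds

/-- **Stub Limʳ `LimRelAtTwo` of line `birth` (skeletons v6/v7, text VERBATIM) — UNCONDITIONAL.** For every `W/ℚ`
(globally minimal model, good ordinary at `2`, no rational `2`-torsion), every `i ∈ ℚ̄` with `i² = −1` such that Iwasawa's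
classical `μ₂` vanishes (growth form) for every cyclotomic `ℤ₂`-extension of `ℚ(W[2]) ⊔ ℚ⟮i⟯`, every cyclotomic datum
`(κ, γ)` and every relaxed-at-`∞` fine Selmer dual datum `Yr` of `W` along `κ`: `ℓ₍₂₎(Yr.X) = 0`
(`LimRelUpstairs.limRelAtTwo_of_lim2017` — Lim's Lemma 3.2 descent into the relaxed receptacle + the dual side — with its
door `hLim` discharged by `stub_limUpstairsDoorAtTwo`). [cite: Lim2017FineSelmer, §3 Thm. 3.5, Lemma 3.2 (arXiv:1306.2047 pp. 6–7)]
[cite: CoatesSujatha2005, §3 statement (A)] [cite: GreenbergLNM1716, §4 Lemma 4.6 (PDF pp. 106–107)] -/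
theorem limRelAtTwo_holds :
    ∀ (W : WeierstrassCurve ℚ) [W.IsElliptic] [W.IsGloballyMinimal], IsOrdinaryAt W 2 →
      (∀ x : ℚ, ¬ HasRationalTwoTorsionX W x) →
      ∀ i : AlgebraicClosure ℚ, i ^ 2 = -1 →
      (∀ κL : ZpExtension ↥(W.divisionField 2 ⊔ IntermediateField.adjoin ℚ {i}) 2,
        κL.IsCyclotomic → ClassicalMuVanishes κL) →
      ∀ (κ : ZpExtension ℚ 2) (γ : Field.absoluteGaloisGroup ℚ), κ.IsCyclotomic →
      κ.IsTopGenerator γ → IsCyclotomicVariable 2 γ →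
      ∀ Yr : W.FineSelmerDualDataRelaxedInf κ γ,
        lengthAt (IwasawaAlgebra 2) Yr.X ⟨IwasawaAlgebra.augIdealP 2, IwasawaAlgebra.isPrime_augIdealP_holds 2⟩ = 0 :=
  limRelAtTwo_of_lim2017 stub_limUpstairsDoorAtTwo

/-- **Coates–Sujatha's statement (A) at `(E, 2)` downstairs, `∃ γ D` form, from classical `μ₂ = 0` on `ℚ(E[2], i)` —
UNCONDITIONAL in the door.** For every elliptic `W/ℚ`, every `i² = −1` with Iwasawa `μ₂ = 0` (growth form) for the cyclotomic
`ℤ₂`-extensions of `ℚ(W[2]) ⊔ ℚ⟮i⟯`, and every cyclotomic `ℤ₂`-extension `κ` of `ℚ`: there are a topological generator `γ` and a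
fine Selmer dual datum `D` along `κ` with `D.X` finitely generated over `ℤ₂`
(`LimRelUpstairs.exists_fineSelmerDualData_moduleFinite_of_lim2017` with `hLim` discharged).
[cite: Lim2017FineSelmer, §3 Thm. 3.5 and Lemma 3.2 (arXiv:1306.2047 pp. 6–7)] [cite: CoatesSujatha2005, §3 statement (A)] -/
theorem exists_fineSelmerDualData_moduleFinite_two (W : WeierstrassCurve ℚ) [W.IsElliptic] (κ : ZpExtension ℚ 2)
    (i : AlgebraicClosure ℚ) (hi : i ^ 2 = -1)
    (hμ : ∀ κL : ZpExtension ↥(W.divisionField 2 ⊔ IntermediateField.adjoin ℚ {i}) 2,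
      κL.IsCyclotomic → ClassicalMuVanishes κL)
    (hκ : κ.IsCyclotomic) :
    ∃ (γ : absoluteGaloisGroup ℚ) (D : W.FineSelmerDualData κ γ),
      Module.Finite ℤ_[2] (RestrictScalars ℤ_[2] (IwasawaAlgebra 2) D.X) :=
  exists_fineSelmerDualData_moduleFinite_of_lim2017 W κ stub_limUpstairsDoorAtTwo i hi hμ hκ

end Summit.BirchSwinnertonDyer.BirchSwinnertonDyer.Theorems.AlignedTransportAtTwoFineRoad.LimDoor

end
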